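import Summits.SmoothPoincare4.SmoothPoincare4.Theses.InformationMetricHadamard
import Summits.SmoothPoincare4.SmoothPoincare4.Theorems.InformationMetricHadamardAhHadamardFillingStubHadamardLocallyConvexIsConvexHelpers
import Literature.Geometry.Riemannian.SimpleAHBoundarySphereProofs
import Literature.Geometry.Riemannian.HopfRinowHeineBorel

/-!
# Stub `stub_hadamardLocallyConvexIsConvex` (A1) of line `Sketch` for crux `AhHadamardFilling`
(item stmt-SmoothPoincare4-6014, route `InformationMetricHadamard`)

**Tietze–Nakajima–Karcher in a Cartan–Hadamard 5-manifold**: in a complete simply connected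
Riemannian 5-manifold with `sec ≤ 0`, a closed connected subset which is locally convex in the
betweenness sense (pointwise radius) is convex in the betweenness sense (H. Karcher, Math. Ann. 177
(1968) 105–121; in `ℝⁿ` Tietze 1928 / Nakajima 1928).  The metric part (discrete curve
shortening) is the registered helper stub `stub_hadamardConvexityToolkit`
(`…StubHadamardLocallyConvexIsConvexHelpers.lean`), about proper metric spaces with (i) geodesics,
(ii) propagation of betweenness along distinct points, (iii) splitting of segments.  This file
supplies (i)–(iii) from the tree (Hopf–Rinow `isGeodesicallyComplete_iff_isCompact_setOf_edist_le`,
`exists_isMinimizingUpTo_of_isGeodesicallyComplete`; the Cartan–Hadamard covering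
`SimpleAH.exp_covering_of_complete`, injective over a simply connected base; corner cutting
`exists_edist_riemannianExpMap_neg_smul_lt`): a between-point of `a, c` lies on the minimizing
geodesic `[a, c]`, whence (ii), (iii); then the Riemannian distance is installed as a proper
`MetricSpace` structure with the manifold topology (Gouëzel) and the toolkit applies.  References:
Karcher 1968; J. M. Lee, *Introduction to Riemannian Manifolds* (2018), Thm. 12.8, Cor. 6.21,
Prop. 10.32 [LeeRiemannianManifolds2018].
-/

noncomputable section

-- the prescribed namespace `Summit.<P>.<Sub>.…` duplicates `SmoothPoincare4` (P = Sub)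
set_option linter.dupNamespace false

open scoped Manifold ContDiff Topology
open Set Function

namespace Summit.SmoothPoincare4.SmoothPoincare4.Cruxes.AhHadamardFilling.Sketch

open Literature.Geometry.Lorentzian
open Literature.Geometry.Lorentzian.PseudoRiemannianMetric
open Literature.Geometry.Riemannian

section Hadamard

variable {X : Type} [TopologicalSpace X] [T2Space X] [ChartedSpace (EuclideanSpace ℝ (Fin 5)) X]
  [IsManifold (𝓡 5) ∞ X] [ConnectedSpace X]
  {G : PseudoRiemannianMetric (𝓡 5) ∞ (EuclideanSpace ℝ (Fin 5)) (TangentSpace (𝓡 5) : X → Type _)}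
  [G.HasLeviCivita] [CovariantDerivative.ContMDiffCovariantDerivative G.leviCivita 1]
  (hG : G.IsRiemannian) (hc : IsGeodesicallyComplete G.leviCivita)
  {D : X → X → ℝ} (hD : ∀ a b : X, D a b = (PseudoRiemannianMetric.edist G hG a b).toReal)

/-! ### The real-valued distance `D` (the Riemannian distance, finite on a connected manifold) -/

omit [T2Space X] [G.HasLeviCivita] [CovariantDerivative.ContMDiffCovariantDerivative G.leviCivita 1] in
include hD in
/-- Triangle inequality for the (finite) Riemannian distance. [folklore] -/
theorem rdist_triangle (a b c : X) : D a c ≤ D a b + D b c := by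
  rw [hD, hD, hD, ← ENNReal.toReal_add (edist_ne_top hG a b) (edist_ne_top hG b c)]
  exact ENNReal.toReal_mono (ENNReal.add_ne_top.2 ⟨edist_ne_top hG a b, edist_ne_top hG b c⟩)
    (edist_triangle hG a b c)

omit [T2Space X] [G.HasLeviCivita] [ConnectedSpace X]
  [CovariantDerivative.ContMDiffCovariantDerivative G.leviCivita 1] in
include hD in
/-- `D ≥ 0`, `D(a, a) = 0`, `D(a, b) = D(b, a)`. [folklore] -/
theorem rdist_basic (a b : X) : 0 ≤ D a b ∧ D a a = 0 ∧ D a b = D b a := by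
  rw [hD, hD, hD, PseudoRiemannianMetric.edist_self, ENNReal.toReal_zero, edist_comm hG a b]
  exact ⟨ENNReal.toReal_nonneg, rfl, rfl⟩

omit [G.HasLeviCivita] [CovariantDerivative.ContMDiffCovariantDerivative G.leviCivita 1] in
include hD in
/-- Definiteness of the Riemannian distance. [folklore] -/
theorem eq_of_rdist_eq_zero {a b : X} (h : D a b = 0) : a = b := by
  haveI : LocallyCompactSpace X := Manifold.locallyCompact_of_finiteDimensional (I := 𝓡 5)
  rw [hD, ENNReal.toReal_eq_zero_iff, or_iff_left (edist_ne_top hG a b)] at h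
  exact (edist_eq_zero_iff hG).1 h

omit [ConnectedSpace X] in
include hc hD in
/-- `d(γ_u(a), γ_u(b)) ≤ b - a` for a unit vector `u` and `a ≤ b`. [folklore] -/
theorem rdist_maximalGeodesic_le [Fact ((1 : ℕ∞ω) ≤ (∞ : ℕ∞ω))] (x : X) {u : TangentSpace (𝓡 5) x}
    (hu : G.val x u u = 1) {a b : ℝ} (hab : a ≤ b) :
    D (maximalGeodesic G.leviCivita x u a) (maximalGeodesic G.leviCivita x u b) ≤ b - a := by
  have h := ENNReal.toReal_mono ENNReal.ofReal_ne_top (edist_maximalGeodesic_le hG hc x hu hab)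
  rwa [ENNReal.toReal_ofReal (sub_nonneg.2 hab), ← hD] at h

/-! ### Minimizing unit-speed geodesics -/

include hc hD in
/-- **Hopf–Rinow**: two distinct points of a complete connected manifold are joined by a
unit-speed geodesic of length `d(x, y)` (Lee 2018, Cor. 6.21). [folklore] -/
theorem exists_unit_maximalGeodesic_eq [Fact ((1 : ℕ∞ω) ≤ (∞ : ℕ∞ω))] {x y : X} (hxy : x ≠ y) :
    ∃ u : TangentSpace (𝓡 5) x, G.val x u u = 1 ∧ maximalGeodesic G.leviCivita x u (D x y) = y := by
  obtain ⟨v, hmin, hvy⟩ := exists_isMinimizingUpTo_of_isGeodesicallyComplete G le_rfl hG hc x y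
  have hd : PseudoRiemannianMetric.edist G hG x y = ENNReal.ofReal (Real.sqrt (G.val x v v)) := by
    rw [← hvy]; exact edist_eq_of_isMinimizingUpTo hG hc hmin
  have hv : v ≠ 0 := by
    rintro rfl
    exact hxy (by rw [← hvy]; exact (riemannianExpMap_zero G x).symm)
  set c := Real.sqrt (G.val x v v) with hcdef
  have hcpos : 0 < c := Real.sqrt_pos.2 (hG x v hv)
  refine ⟨c⁻¹ • v, ?_, ?_⟩
  · simp only [map_smul, smul_apply, smul_eq_mul]
    rw [← Real.sq_sqrt (hG x v hv).le, ← hcdef]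
    field_simp
  · rw [hD, hd, ENNReal.toReal_ofReal hcpos.le, maximalGeodesic_smul hc x v c⁻¹ c,
      inv_mul_cancel₀ hcpos.ne', ← expMap_eq_maximalGeodesic hc x v]
    exact hvy

include hc hD in
/-- **A geodesic through two points at parameter distance `d(x, y)` is a metric segment**:
`d(γ(s), γ(t)) = t - s` for `0 ≤ s ≤ t ≤ d(x, y)` (lengths above, triangle inequality below). [folklore] -/
theorem rdist_maximalGeodesic_eq [Fact ((1 : ℕ∞ω) ≤ (∞ : ℕ∞ω))] {x y : X} {u : TangentSpace (𝓡 5) x}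
    (hu : G.val x u u = 1) (hy : maximalGeodesic G.leviCivita x u (D x y) = y)
    {s t : ℝ} (hs : 0 ≤ s) (hst : s ≤ t) (ht : t ≤ D x y) :
    D (maximalGeodesic G.leviCivita x u s) (maximalGeodesic G.leviCivita x u t) = t - s := by
  have h1 := rdist_maximalGeodesic_le hG hc hD x hu hs
  have h3 := rdist_maximalGeodesic_le hG hc hD x hu ht
  rw [(maximalGeodesic_of_isGeodesicallyComplete hc x u).2.2.1] at h1
  rw [hy] at h3
  set a := maximalGeodesic G.leviCivita x u s
  linarith [rdist_triangle hG hD x a y, rdist_triangle hG hD a (maximalGeodesic G.leviCivita x u t) y,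
    rdist_maximalGeodesic_le hG hc hD x hu hst]

/-! ### No corners, uniqueness, betweenness -/

include hc hD in
/-- **A minimizing broken geodesic has no corner** (Lee 2018, proof of Prop. 10.32 (a), corner
cutting `exists_edist_riemannianExpMap_neg_smul_lt`): if `σ = γ_w` starts at `γ_u(T)` and
`d(x, σ(S)) = T + S` (`u, w` unit, `T, S > 0`), then `w = γ_u'(T)`. [folklore] -/
theorem velocity_eq_of_rdist_eq [Fact ((1 : ℕ∞ω) ≤ (∞ : ℕ∞ω))] {x : X} {u : TangentSpace (𝓡 5) x}
    (hu : G.val x u u = 1) {T S : ℝ} (hT : 0 < T) (hS : 0 < S)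
    {w : TangentSpace (𝓡 5) (maximalGeodesic G.leviCivita x u T)}
    (hw : G.val (maximalGeodesic G.leviCivita x u T) w w = 1)
    (hbtw : D x (maximalGeodesic G.leviCivita (maximalGeodesic G.leviCivita x u T) w S) = T + S) :
    w = velocity (𝓡 5) (maximalGeodesic G.leviCivita x u) T := by
  have hu' : G.val (maximalGeodesic G.leviCivita x u T)
      (velocity (𝓡 5) (maximalGeodesic G.leviCivita x u) T)
      (velocity (𝓡 5) (maximalGeodesic G.leviCivita x u) T) = 1 := by
    rw [val_velocity_maximalGeodesic hc x u T, hu]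
  by_contra hne
  obtain ⟨s₀, hs₀, hcut⟩ := exists_edist_riemannianExpMap_neg_smul_lt G le_rfl hG _ _ w hu' hw
    (Ne.symm hne)
  set s : ℝ := min (s₀ / 2) (min T S) with hs
  have hspos : 0 < s := lt_min (half_pos hs₀) (lt_min hT hS)
  have hss₀ : s < s₀ := (min_le_left _ _).trans_lt (half_lt_self hs₀)
  have hsT : s ≤ T := (min_le_right _ _).trans (min_le_left _ _)
  have hsS : s ≤ S := (min_le_right _ _).trans (min_le_right _ _)
  have key₁ : D (maximalGeodesic G.leviCivita x u (T - s))
      (maximalGeodesic G.leviCivita (maximalGeodesic G.leviCivita x u T) w s) < 2 * s := by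
    have h := hcut s hspos hss₀
    rw [riemannianExpMap_eq, expMap_smul hc, expMap_smul hc,
      maximalGeodesic_velocity_apply hc x u T (-s), show -s + T = T - s by ring] at h
    have h' := ENNReal.toReal_strict_mono ENNReal.ofReal_ne_top h
    rwa [ENNReal.toReal_ofReal (by positivity), ← hD] at h'
  have h1 : D x (maximalGeodesic G.leviCivita x u (T - s)) ≤ T - s := by
    have h := rdist_maximalGeodesic_le hG hc hD x hu (sub_nonneg.2 hsT)
    rwa [(maximalGeodesic_of_isGeodesicallyComplete hc x u).2.2.1, sub_zero] at h
  have h2 := rdist_maximalGeodesic_le hG hc hD _ hw hsS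
  set y₁ := maximalGeodesic G.leviCivita x u (T - s)
  set z₁ := maximalGeodesic G.leviCivita (maximalGeodesic G.leviCivita x u T) w s
  set z₂ := maximalGeodesic G.leviCivita (maximalGeodesic G.leviCivita x u T) w S
  linarith [rdist_triangle hG hD x y₁ z₂, rdist_triangle hG hD y₁ z₁ z₂]

include hc in
omit [ConnectedSpace X] in
/-- **Uniqueness of geodesics when `exp_x` is injective**: unit-speed geodesics from `x` meeting at
nonnegative parameters have equal parameters and, if these are positive, directions. [folklore] -/
theorem eq_of_maximalGeodesic_eq (hinj : ∀ p : X, Injective fun v : EuclideanSpace ℝ (Fin 5) ↦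
      expMap G.leviCivita p (show TangentSpace (𝓡 5) p from v))
    {x : X} {u u' : TangentSpace (𝓡 5) x} (hu : G.val x u u = 1) (hu' : G.val x u' u' = 1)
    {T T' : ℝ} (hT : 0 ≤ T) (hT' : 0 ≤ T')
    (h : maximalGeodesic G.leviCivita x u T = maximalGeodesic G.leviCivita x u' T') :
    T = T' ∧ (T ≠ 0 → u = u') := by
  rw [← expMap_smul hc, ← expMap_smul hc] at h
  have hvv : T • u = T' • u' := hinj x h
  have hTT : T = T' := by
    have h1 : G.val x (T • u) (T • u) = G.val x (T' • u') (T' • u') := by rw [hvv]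
    simp only [map_smul, smul_apply, smul_eq_mul, hu, hu', mul_one] at h1
    nlinarith
  rw [← hTT] at hvv
  exact ⟨hTT, fun hT0 ↦ smul_right_injective _ hT0 hvv⟩

include hc hD in
/-- **A between-point lies on the minimizing geodesic** (Lemma B): if `γ_u`, `u` unit, reaches `c`
at parameter `d(a, c)` and `d(a, m) + d(m, c) = d(a, c)`, then `m = γ_u(d(a, m))` (no corner at
`m` of the broken minimizer `a → m → c`; uniqueness of the geodesic `a → c`). [folklore] -/
theorem eq_maximalGeodesic_of_between [Fact ((1 : ℕ∞ω) ≤ (∞ : ℕ∞ω))]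
    (hinj : ∀ p : X, Injective fun v : EuclideanSpace ℝ (Fin 5) ↦
      expMap G.leviCivita p (show TangentSpace (𝓡 5) p from v))
    {a c m : X} {u : TangentSpace (𝓡 5) a} (hu : G.val a u u = 1)
    (hac : maximalGeodesic G.leviCivita a u (D a c) = c) (hm : D a m + D m c = D a c) :
    m = maximalGeodesic G.leviCivita a u (D a m) := by
  by_cases ham : a = m
  · subst ham
    rw [(rdist_basic hG hD a a).2.1]
    exact (maximalGeodesic_of_isGeodesicallyComplete hc a u).2.2.1.symm
  by_cases hmc : m = c
  · subst hmc
    rw [(rdist_basic hG hD m m).2.1, add_zero] at hm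
    rw [hm, hac]
  obtain ⟨u₁, hu₁, hm₁⟩ := exists_unit_maximalGeodesic_eq hG hc hD ham
  obtain ⟨w, hw, hc₁⟩ := exists_unit_maximalGeodesic_eq hG hc hD
    (x := maximalGeodesic G.leviCivita a u₁ (D a m)) (y := c) (by rw [hm₁]; exact hmc)
  have hDm : D (maximalGeodesic G.leviCivita a u₁ (D a m)) c = D m c := by rw [hm₁]
  rw [hDm] at hc₁
  have h0m : 0 < D a m :=
    lt_of_le_of_ne (rdist_basic hG hD a m).1 fun h ↦ ham (eq_of_rdist_eq_zero hG hD h.symm)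
  have h0c : 0 < D m c :=
    lt_of_le_of_ne (rdist_basic hG hD m c).1 fun h ↦ hmc (eq_of_rdist_eq_zero hG hD h.symm)
  have hwv := velocity_eq_of_rdist_eq hG hc hD hu₁ h0m h0c hw (by rw [hc₁, hm])
  have hc₂ : maximalGeodesic G.leviCivita a u₁ (D a c) = c := by
    conv_rhs => rw [← hc₁]
    rw [hwv, maximalGeodesic_velocity_apply hc a u₁, ← hm, add_comm]
  have hac0 : D a c ≠ 0 := by linarith
  obtain ⟨-, huu⟩ := eq_of_maximalGeodesic_eq hc hinj hu₁ hu (rdist_basic hG hD a c).1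
    (rdist_basic hG hD a c).1 (hc₂.trans hac.symm)
  rw [← huu hac0]
  exact hm₁.symm

include hc hD in
/-- **Propagation of betweenness** in a Cartan–Hadamard manifold: `b ∈ [a,c]`, `c ∈ [b,d]`,
`b ≠ c` imply `c ∈ [a,d]` (the minimizers `a → c` and `b → d` continue one another through the
common piece `[b,c]`, so `d` lies on the geodesic from `a` at parameter `d(a,b)+d(b,c)+d(c,d)`,
which is `d(a,d)` by uniqueness of the geodesic `a → d`). [folklore] -/
theorem between_propagate [Fact ((1 : ℕ∞ω) ≤ (∞ : ℕ∞ω))]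
    (hinj : ∀ p : X, Injective fun v : EuclideanSpace ℝ (Fin 5) ↦
      expMap G.leviCivita p (show TangentSpace (𝓡 5) p from v))
    {a b c d : X} (habc : D a b + D b c = D a c) (hbcd : D b c + D c d = D b d)
    (hbc : b ≠ c) : D a c + D c d = D a d := by
  have hpos : ∀ x y : X, x ≠ y → 0 < D x y := fun x y hxy ↦
    lt_of_le_of_ne (rdist_basic hG hD x y).1 fun h ↦ hxy (eq_of_rdist_eq_zero hG hD h.symm)
  have h0bc := hpos b c hbc
  by_cases hab : a = b
  · subst hab; exact hbcd
  by_cases hcd : c = d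
  · subst hcd; rw [(rdist_basic hG hD c c).2.1, add_zero]
  have h0ab := hpos a b hab
  have hac : a ≠ c := fun h ↦ by subst h; linarith [(rdist_basic hG hD a a).2.1]
  have had : a ≠ d := by
    intro h; subst h
    rw [(rdist_basic hG hD c a).2.2, (rdist_basic hG hD b a).2.2] at hbcd
    linarith
  -- the minimizer `γ` from `a` to `c` passes through `b`
  obtain ⟨u, hu, hγc⟩ := exists_unit_maximalGeodesic_eq hG hc hD hac
  have hγb := eq_maximalGeodesic_of_between hG hc hD hinj hu hγc habc
  -- the minimizer `σ` from `b = γ(d(a,b))` to `d` passes through `c`, hence continues `γ`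
  have hbd : maximalGeodesic G.leviCivita a u (D a b) ≠ d := by
    rw [← hγb]; rintro rfl; linarith [(rdist_basic hG hD b b).2.1, (rdist_basic hG hD c b).1]
  obtain ⟨w, hw, hσd⟩ := exists_unit_maximalGeodesic_eq hG hc hD hbd
  have hyb : ∀ z, D (maximalGeodesic G.leviCivita a u (D a b)) z = D b z := fun z ↦ by rw [← hγb]
  rw [hyb] at hσd
  have hσc := eq_maximalGeodesic_of_between hG hc hD hinj hw (by rw [hyb]; exact hσd)
    (m := c) (by rw [hyb, hyb]; exact hbcd)
  rw [hyb] at hσc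
  have hwv := velocity_eq_of_rdist_eq hG hc hD hu h0ab h0bc hw (by rw [← hσc, ← habc])
  have hd' : maximalGeodesic G.leviCivita a u (D a b + D b d) = d := by
    conv_rhs => rw [← hσd]
    rw [hwv, maximalGeodesic_velocity_apply hc a u, add_comm]
  obtain ⟨u', hu', hd''⟩ := exists_unit_maximalGeodesic_eq hG hc hD had
  obtain ⟨hL, -⟩ := eq_of_maximalGeodesic_eq hc hinj hu hu' (by linarith [(rdist_basic hG hD b d).1])
    (rdist_basic hG hD a d).1 (hd'.trans hd''.symm)
  linarith

include hc hD in
/-- **Splitting of segments**: if `b, m ∈ [a,c]` then `m ∈ [a,b]` or `m ∈ [b,c]` (both lie on the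
minimizing geodesic `a → c`, which is a metric segment). [folklore] -/
theorem between_split [Fact ((1 : ℕ∞ω) ≤ (∞ : ℕ∞ω))]
    (hinj : ∀ p : X, Injective fun v : EuclideanSpace ℝ (Fin 5) ↦
      expMap G.leviCivita p (show TangentSpace (𝓡 5) p from v))
    {a b c m : X} (habc : D a b + D b c = D a c) (hamc : D a m + D m c = D a c) :
    D a m + D m b = D a b ∨ D b m + D m c = D b c := by
  by_cases hac : a = c
  · subst hac
    have h0 : D a m = 0 := by
      linarith [(rdist_basic hG hD a m).1, (rdist_basic hG hD m a).1, (rdist_basic hG hD a a).2.1]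
    left
    rw [eq_of_rdist_eq_zero hG hD h0, (rdist_basic hG hD m m).2.1, zero_add]
  obtain ⟨u, hu, hγc⟩ := exists_unit_maximalGeodesic_eq hG hc hD hac
  have hγb := eq_maximalGeodesic_of_between hG hc hD hinj hu hγc habc
  have hγm := eq_maximalGeodesic_of_between hG hc hD hinj hu hγc hamc
  have hbc0 := (rdist_basic hG hD b c).1
  have hmc0 := (rdist_basic hG hD m c).1
  rcases le_total (D a m) (D a b) with hle | hle
  · have h := rdist_maximalGeodesic_eq hG hc hD hu hγc (rdist_basic hG hD a m).1 hle (by linarith)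
    rw [← hγm, ← hγb] at h
    exact Or.inl (by linarith)
  · have h := rdist_maximalGeodesic_eq hG hc hD hu hγc (rdist_basic hG hD a b).1 hle (by linarith)
    rw [← hγm, ← hγb] at h
    exact Or.inr (by linarith)

/-! ### `exp_p` is injective on a Cartan–Hadamard manifold -/

include hG hc in
/-- **On a simply connected complete manifold with `Rm(X,Y,Y,X) ≤ 0`, `exp_p` is injective**: it
is a covering map (Cartan–Hadamard, `SimpleAH.exp_covering_of_complete`) from the connected `ℝ⁵`
onto a simply connected base, so the lift of `id` through `0` is a two-sided inverse. [folklore] -/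
theorem expMap_injective [SimplyConnectedSpace X]
    [CovariantDerivative.ContMDiffCovariantDerivative G.leviCivita ∞]
    (hsec : ∀ (x : X) (U V : TangentSpace (𝓡 5) x), G.curvatureForm G.leviCivita x U V V U ≤ 0)
    (p : X) :
    Injective fun v : EuclideanSpace ℝ (Fin 5) ↦ expMap G.leviCivita p (show TangentSpace (𝓡 5) p from v) := by
  haveI : LocallyPathConnectedSpace X :=
    ChartedSpace.locallyPathConnectedSpace (EuclideanSpace ℝ (Fin 5)) X
  obtain ⟨-, -, -, hcov⟩ := SimpleAH.exp_covering_of_complete hG hc hsec p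
  set F : EuclideanSpace ℝ (Fin 5) → X :=
    fun v ↦ expMap G.leviCivita p (show TangentSpace (𝓡 5) p from v) with hF
  obtain ⟨s, ⟨hs0, hs⟩, -⟩ := hcov.existsUnique_continuousMap_lifts (ContinuousMap.id X) (F 0) 0 rfl
  have hs' : F ∘ (s : X → EuclideanSpace ℝ (Fin 5)) = id := hs
  have hsec' : (s : X → EuclideanSpace ℝ (Fin 5)) ∘ F = id := by
    refine hcov.eq_of_comp_eq (s.continuous.comp hcov.continuous) continuous_id ?_ 0 (by simp [hs0])
    change (F ∘ (s : X → EuclideanSpace ℝ (Fin 5))) ∘ F = F ∘ id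
    rw [hs']; rfl
  exact LeftInverse.injective (g := s) fun v ↦ congrFun hsec' v

end Hadamard

/-! ### The registered stub -/

/-- **A1 (Tietze–Nakajima–Karcher).** In a complete (closed distance balls compact) simply connected
Riemannian 5-manifold with `sec ≤ 0` for every Levi-Civita connection, a closed connected subset
`C` which is locally `d`-convex — every point of `C` has a radius `δ` such that every metric
between-point of two points of `C` `δ`-close to it lies in `C` — is `d`-convex (betweenness form).
H. Karcher, Math. Ann. 177 (1968) 105–121; in `ℝⁿ` Tietze 1928 / Nakajima 1928. [folklore] -/
theorem stub_hadamardLocallyConvexIsConvex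
    (X : Type) [TopologicalSpace X] [T2Space X] [SecondCountableTopology X]
    [ChartedSpace (EuclideanSpace ℝ (Fin 5)) X] [IsManifold (𝓡 5) ∞ X] [SimplyConnectedSpace X]
    (G : PseudoRiemannianMetric (𝓡 5) ∞ (EuclideanSpace ℝ (Fin 5)) (TangentSpace (𝓡 5) : X → Type _))
    (hG : G.IsRiemannian) :
    (∀ (x : X) (r : NNReal), IsCompact {y : X | G.edist hG x y ≤ r}) →
    (∀ cov, G.IsLeviCivita cov →
      ∀ (x : X) (U V : TangentSpace (𝓡 5) x), G.sectionalCurvature cov x U V ≤ 0) →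
    ∀ (C : Set X), IsClosed C → IsConnected C →
    (∀ p ∈ C, ∃ δ : ℝ, 0 < δ ∧ ∀ q ∈ C, ∀ q' ∈ C,
      G.edist hG p q < ENNReal.ofReal δ → G.edist hG p q' < ENNReal.ofReal δ →
      ∀ m : X, G.edist hG q m + G.edist hG m q' = G.edist hG q q' → m ∈ C) →
    ∀ p ∈ C, ∀ q ∈ C, ∀ m : X, G.edist hG p m + G.edist hG m q = G.edist hG p q → m ∈ C := by
  intro hcpt hsec C hC hconn hloc
  -- instances and standing facts
  haveI : LocallyCompactSpace X := Manifold.locallyCompact_of_finiteDimensional (I := 𝓡 5)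
  haveI hLC : G.HasLeviCivita := G.hasLeviCivita
  have hk1 : ((1 : ℕ∞) : ℕ∞ω) + 1 ≤ (∞ : ℕ∞ω) := by
    rw [show ((1 : ℕ∞) : ℕ∞ω) + 1 = 2 by norm_num]; exact WithTop.coe_le_coe.2 le_top
  haveI : CovariantDerivative.ContMDiffCovariantDerivative G.leviCivita 1 :=
    ⟨G.isLocallyContMDiff_leviCivita_holds 1 hk1 univ isOpen_univ⟩
  haveI : CovariantDerivative.ContMDiffCovariantDerivative G.leviCivita ∞ :=
    ⟨G.isLocallyContMDiff_leviCivita_holds ⊤ (le_of_eq rfl) univ isOpen_univ⟩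
  haveI : Fact ((1 : ℕ∞ω) ≤ (∞ : ℕ∞ω)) := ⟨by exact_mod_cast le_top⟩
  have hc : IsGeodesicallyComplete G.leviCivita :=
    (isGeodesicallyComplete_iff_isCompact_setOf_edist_le G le_rfl hG).2 hcpt
  have hsec' : ∀ (x : X) (U V : TangentSpace (𝓡 5) x), G.curvatureForm G.leviCivita x U V V U ≤ 0 := by
    have hLC' : G.IsLeviCivita G.leviCivita := isLeviCivita_leviCivita_holds (g := G)
    refine SimpleAH.curvatureForm_leviCivita_nonpos_of_orthonormal (WithTop.coe_le_coe.2 le_top) hG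
      (fun x U V hU hV hUV ↦ ?_)
    rw [← sectionalCurvature_of_orthonormal G G.leviCivita x hU hV hUV]
    exact hsec _ hLC' x U V
  have hinj := expMap_injective hG hc hsec'
  -- the Riemannian distance as a proper metric space structure with the manifold topology
  letI := G.riemannianBundle hG
  haveI := G.isContinuousRiemannianBundle hG
  letI : EMetricSpace X := .ofRiemannianMetric (𝓡 5) X
  letI : MetricSpace X := EMetricSpace.toMetricSpace fun x y ↦ edist_ne_top hG x y
  have hD : ∀ a b : X, dist a b = (G.edist hG a b).toReal := fun _ _ ↦ rfl
  have hofReal : ∀ a b : X, G.edist hG a b = ENNReal.ofReal (dist a b) := fun a b ↦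
    (ENNReal.ofReal_toReal (edist_ne_top hG a b)).symm
  haveI : ProperSpace X := by
    refine ⟨fun x r ↦ ?_⟩
    rcases lt_or_ge r 0 with hr | hr
    · rw [Metric.closedBall_eq_empty.2 hr]; exact isCompact_empty
    have hset : Metric.closedBall x r = {y : X | G.edist hG x y ≤ r.toNNReal} := by
      ext y; rw [Metric.mem_closedBall, dist_comm, mem_setOf_eq, hofReal]
      exact (ENNReal.ofReal_le_ofReal_iff hr).symm
    rw [hset]; exact hcpt x r.toNNReal
  have hbtw : ∀ a m b : X, G.edist hG a m + G.edist hG m b = G.edist hG a b ↔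
      dist a m + dist m b = dist a b := fun a m b ↦ by
    rw [hofReal, hofReal, hofReal, ← ENNReal.ofReal_add dist_nonneg dist_nonneg,
      ENNReal.ofReal_eq_ofReal_iff (by positivity) dist_nonneg]
  have hlt : ∀ (a b : X) (δ : ℝ), G.edist hG a b < ENNReal.ofReal δ ↔ dist a b < δ := fun a b δ ↦ by
    rw [hofReal, ENNReal.ofReal_lt_ofReal_iff_of_nonneg dist_nonneg]
  -- the metric toolkit
  intro p hp q hq m hm
  refine stub_hadamardConvexityToolkit X ?_ ?_ ?_ C hC hconn ?_ p hp q hq m ((hbtw p m q).1 hm)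
  · intro x y
    by_cases hxy : x = y
    · subst hxy
      refine ⟨fun _ ↦ x, rfl, rfl, fun s t _ hst ht ↦ ?_⟩
      rw [dist_self] at ht ⊢
      linarith
    obtain ⟨u, hu, hy⟩ := exists_unit_maximalGeodesic_eq hG hc hD hxy
    exact ⟨maximalGeodesic G.leviCivita x u, (maximalGeodesic_of_isGeodesicallyComplete hc x u).2.2.1,
      hy, fun s t hs hst ht ↦ rdist_maximalGeodesic_eq hG hc hD hu hy hs hst ht⟩
  · exact fun a b c d h1 h2 h3 ↦ between_propagate hG hc hD hinj h1 h2 h3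
  · exact fun a b c m h1 h2 ↦ between_split hG hc hD hinj h1 h2
  · intro x hx
    obtain ⟨δ, hδ, hδC⟩ := hloc x hx
    exact ⟨δ, hδ, fun q hq q' hq' h1 h2 m hm ↦ hδC q hq q' hq' ((hlt x q δ).2 h1) ((hlt x q' δ).2 h2)
      m ((hbtw q m q').2 hm)⟩

end Summit.SmoothPoincare4.SmoothPoincare4.Cruxes.AhHadamardFilling.Sketch
end
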